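import Mathlib.FieldTheory.RatFunc.Degree
import Mathlib.FieldTheory.RatFunc.AsPolynomial
import Mathlib.Topology.MetricSpace.Ultra.TotallySeparated
import Literature.AnabelianGeometry.AbsoluteAnabelian.AbsTopIII.CuspidalCyclotome
import Literature.AnabelianGeometry.AbsoluteAnabelian.FreeProcyclicModel
import Literature.AnabelianGeometry.AbsoluteAnabelian.SubpadicExamples
import HarnessLib

/-!
# FACT-LIST rows F-0343 / F-0344 / F-0345 ([AbsTopIII] Prop. 1.6 (iii), Prop. 1.8 (i), (ii), Kummer
# classes of regular units, RELATIVE TO A MODEL `M : KummerCurveModel`) are SCHEMAS: their universal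
# closures are refuted — modulo the existence of one Kummer-faithful field — by an explicit junk model

Mochizuki, *Topics in Absolute Anabelian Geometry III*, §1, Prop. 1.6 (iii) p. 35, Prop. 1.8 (i), (ii)
p. 36 (manuscript pages, lit key `paper:url-5493eb38cbb7`).  Proof-only companion to
`CuspidalCyclotome.lean` (cell abc-iut, D-0078 block F, seat f-078, tranche 78 of plan/F-TRANCHES.tsv).

The three named facts `Prop_1_6_iii_units M`, `Prop_1_8_i_units M`, `Prop_1_8_ii_units M` are predicates
on the INTERFACE `KummerCurveModel` (a `CurveModel` plus regular units `Γ(U, 𝒪_U^×)` and a Kummer map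
`κ_U`, all FREE data of `M`).  The frozen FACT-LIST lists them as bindable BY NAME; bound as CLOSED facts
(`∀ M, …`) they would be false as soon as a single Kummer-faithful field exists, as this file shows at
the explicit model `KummerUnitsClosureWitness.model k` over an arbitrary field `k` of characteristic
zero:

* one curve `U = U_x = X`; `Π_U := G_k × Ẑ ↠ G_k` (`Ẑ = ∏_p ℤ_p`, so `Δ_U = Ẑ`), one cusp `x` with
  `D_x = Π_U` (rational) and `I_x = Δ_U ≅ Ẑ` (free procyclic, `isFreeProcyclic_padicProd`); the
  "cuspidal quotient" `Π_U ↠ Π_X` is the endomorphism `(γ, z) ↦ (γ, 1)`, whose cuspidal kernel is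
  `Δ_U = I_x` and whose cuspidally central modulus `[Δ, Δ]⁻` is trivial — so `(U_x ⊆ X, x)` IS a
  cyclotome presentation in the sense of `CurveModel.IsCyclotomePresentation` (PROVED,
  `KummerUnitsClosureWitness.isCyclotomePresentation`);
* `K_U := k(X)` (`RatFunc k`), `Γ(U, 𝒪_U^×) := K_U^×`, the Kummer map `κ_U := 1` (trivial), every
  NF-predicate `:= True` except `IsNFConstant := False`, one closed point with `D := Π_U`.

Then the unit `X ∈ k(X)^×` is nonconstant while `κ_U(X) = 0` restricts to `0` everywhere, which
contradicts each of the three displayed equivalences.  The ONLY hypothesis of the three facts that the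
junk model cannot discharge by itself is `IsKummerFaithful (M.base U)` ([AbsTopIII] Def. 1.5; its
abelian-variety clause is not provable for any concrete field with the tree's present algebraic
geometry), whence the CONDITIONAL form of the refutations:

* `not_forall_prop_1_6_iii_units_of_isKummerFaithful` etc.: `IsKummerFaithful k → ¬ ∀ M, Prop_… M`;
* `forall_prop_1_6_iii_units_iff_no_kummerFaithful` etc.: the closed form `∀ M, Prop_… M` is
  EQUIVALENT to "no field (in `Type`) is Kummer-faithful" (the converse direction is vacuity);
* `not_forall_prop_1_6_iii_units_of_rmk_1_5_4_i` etc.: under the sibling FACT-LIST row F-0369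
  `Rmk_1_5_4_i` ("sub-`p`-adic ⟹ Kummer-faithful", [AbsTopIII] Rmk. 1.5.4 (i) p. 33) applied to `ℚ_2`
  (`IsSubpadicFor.padic`), the universal closures of F-0343/0344/0345 are FALSE — i.e. the closed forms
  of these three rows are jointly INCONSISTENT with F-0369 and must not be bound together as hypotheses
  of a conditional certificate.

Consequence for the bookkeeping only: F-0343/0344/0345 are SCHEMAS (class R5) — consumable in instance
form at the genuine étale-`π₁` model, where the printed Prop. 1.6 (iii) / 1.8 live, never as closed
facts.  Nothing here bears on the printed propositions (the junk model is not a hyperbolic curve), no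
side is taken on [IUTchIII] Cor. 3.12; typed ≠ proved; refuting a universal closure ≠ refuting print.
-/

noncomputable section

open CategoryTheory

namespace Literature.AnabelianGeometry.AbsoluteAnabelian.AbsTopIII

namespace KummerUnitsClosureWitness

variable (k : Type) [Field k] [CharZero k]

/-- `Ẑ = ∏_p ℤ_p`, written multiplicatively (the tree's model of "`≅ Ẑ`",
`isFreeProcyclic_padicProd`). [cite: MochizukiAbsTopIII2015, Prop 1.4 (i) p.31] -/
abbrev Zhat : Type := Multiplicative (∀ p : Nat.Primes, @PadicInt (p : ℕ) ⟨p.2⟩)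

/-- The junk arithmetic fundamental group `Π := G_k × Ẑ`. [cite: MochizukiAbsTopIII2015, Prop 1.4 p.31] -/
abbrev Arith : Type := Field.absoluteGaloisGroup k × Zhat

/-- The junk extension `1 → Ẑ → G_k × Ẑ → G_k → 1` (first projection).
[cite: MochizukiAbsTopIII2015, Prop 1.4 p.31] -/
def ext : FundamentalExtension.{0} where
  arith := ProfiniteGrp.of (Arith k)
  gal := absoluteGaloisGrp k
  aug := ContinuousMonoidHom.fst (Field.absoluteGaloisGroup k) Zhat
  aug_surjective := fun g => ⟨(g, 1), rfl⟩

/-- Membership in `Δ = Ker(Π ↠ G_k)`: the first coordinate is trivial.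
[cite: MochizukiAbsTopIII2015, Prop 1.4 p.31] -/
theorem mem_geom_iff (x : (ext k).arith) : x ∈ (ext k).geom ↔ x.1 = 1 := Iff.rfl

/-- The junk "cuspidal quotient" `Π_{U_x} ↠ Π_X`: the endomorphism `(γ, z) ↦ (γ, 1)` of the junk
extension (over the identity of `G_k`). [cite: MochizukiAbsTopIII2015, Prop 1.4 (i) p.31] -/
def resHom : ext k ⟶ ext k where
  arith := (ContinuousMonoidHom.inl (Field.absoluteGaloisGroup k) Zhat).comp
    (ContinuousMonoidHom.fst (Field.absoluteGaloisGroup k) Zhat)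
  gal := ContinuousMonoidHom.id _
  comm := fun _ => rfl

/-- `resHom (γ, z) = (γ, 1)`. [cite: MochizukiAbsTopIII2015, Prop 1.4 (i) p.31] -/
@[simp] theorem resHom_arith_apply (x : (ext k).arith) : (resHom k).arith x = (x.1, 1) := rfl

/-- The junk cuspidal data: ONE cusp with decomposition group `D_x = Π` and inertia group
`I_x = Δ`. [cite: MochizukiAbsTopIII2015, Prop 1.4 (i) p.31] -/
def cusps : (ext k).CuspidalData where
  Cusp := PUnit
  Dcusp := fun _ => ⊤
  Icusp := fun _ => (ext k).geom
  Icusp_eq := fun _ => (top_inf_eq (ext k).geom).symm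
  isClosed_Dcusp := fun _ => by
    rw [Subgroup.coe_top]
    exact isClosed_univ
  eq_of_conj := fun _ _ _ _ => rfl

/-- THE JUNK MODEL over `k`: one curve, `Π = G_k × Ẑ`, `K_U = k(X)`, all units regular, trivial
Kummer map, `IsNFConstant := False`, every other predicate `:= True`.
[cite: MochizukiAbsTopIII2015, Prop 1.6 p.34] -/
def model : KummerCurveModel.{0} where
  Curve := PUnit
  base := fun _ => k
  instField := fun _ => inferInstance
  instCharZero := fun _ => inferInstance
  ext := fun _ => ext k
  galIso := fun _ => Iso.refl _
  cusps := fun _ => cusps k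
  IsProper := fun _ => True
  IsScheme := fun _ => True
  genus := fun _ => 0
  FunctionField := fun _ => RatFunc k
  instFunctionField := fun _ => inferInstance
  instAlgebra := fun _ => inferInstance
  Point := fun _ => PUnit
  decomp := fun _ _ => ⊤
  IsNFCurve := fun _ => True
  IsNFPoint := fun _ _ => True
  IsNFRational := fun _ _ => True
  IsNFConstant := fun _ _ => False
  NFFunctionField := fun _ => k
  instNFFunctionField := fun _ => inferInstance
  IsStrictlyBelyiType := fun _ => True
  IsCofiniteOpen := fun _ _ => True
  res := fun _ => resHom k
  regularUnits := fun _ => ⊤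
  kummer := fun _ _ => 1

/-! ### The junk presentation is a cyclotome presentation -/

/-- `Ẑ ≃ Δ = {1} × Ẑ` as topological groups. [cite: MochizukiAbsTopIII2015, Prop 1.4 (i) p.31] -/
def zhatEquivGeom : Zhat ≃ₜ* (ext k).geom where
  toFun z := ⟨((1 : Field.absoluteGaloisGroup k), z), rfl⟩
  invFun x := x.1.2
  left_inv _ := rfl
  right_inv x := Subtype.ext (Prod.ext ((mem_geom_iff k x.1).mp x.2).symm rfl)
  map_mul' _ _ := Subtype.ext (Prod.ext (one_mul _).symm rfl)
  continuous_toFun := (continuous_const.prodMk continuous_id).subtype_mk _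
  continuous_invFun := continuous_snd.comp continuous_subtype_val

/-- `I_x = Δ ≅ Ẑ` is free procyclic. [cite: MochizukiAbsTopIII2015, Prop 1.4 (i) p.31] -/
theorem isFreeProcyclic_geom : FundamentalExtension.IsFreeProcyclic (ext k).geom :=
  isFreeProcyclic_padicProd.of_continuousMulEquiv (zhatEquivGeom k)

/-- The kernel of the junk cuspidal quotient is `Δ`. [cite: MochizukiAbsTopIII2015, Prop 1.4 (i) p.31] -/
theorem ker_resHom : (resHom k).arith.toMonoidHom.ker = (ext k).geom := by
  ext x
  rw [MonoidHom.mem_ker, mem_geom_iff]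
  change ((x.1, (1 : Zhat)) : Arith k) = 1 ↔ _
  rw [Prod.mk_eq_one]
  exact and_iff_left rfl

/-- The cuspidal kernel `N = Ker(Δ_{U_x} ↠ Δ_X)` of the junk quotient is `Δ = I_x`.
[cite: MochizukiAbsTopIII2015, Prop 1.4 (ii) p.31] -/
theorem cuspidalKernel_resHom : cuspidalKernel (resHom k) = (ext k).geom := by
  rw [cuspidalKernel, ker_resHom, inf_idem]

/-- `Δ = {1} × Ẑ` is commutative: `[Δ, Δ] = 1`. [cite: MochizukiAbsTopIII2015, Prop 1.4 (ii) p.31] -/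
theorem commutator_geom : ⁅(ext k).geom, (ext k).geom⁆ = ⊥ := by
  rw [Subgroup.commutator_eq_bot_iff_le_centralizer]
  intro x hx y hy
  rw [mem_geom_iff] at hx
  rw [SetLike.mem_coe, mem_geom_iff] at hy
  refine Prod.ext ?_ ?_
  · change y.1 * x.1 = x.1 * y.1
    rw [hx, hy]
  · change y.2 * x.2 = x.2 * y.2
    exact mul_comm _ _

/-- The cuspidally central modulus `[N, Δ]⁻` of the junk quotient is trivial.
[cite: MochizukiAbsTopIII2015, Prop 1.4 (ii) p.31] -/
theorem cuspidallyCentralModulus_resHom : cuspidallyCentralModulus (resHom k) = ⊥ := by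
  rw [cuspidallyCentralModulus, cuspidalKernel_resHom, commutator_geom]
  refine le_antisymm (Subgroup.topologicalClosure_minimal _ le_rfl ?_) bot_le
  rw [Subgroup.coe_bot]
  exact isClosed_singleton

/-- `Δ` is its own closed normal closure. [cite: MochizukiAbsTopIII2015, Prop 1.4 (i) p.31] -/
theorem topologicalClosure_normalClosure_geom :
    (Subgroup.normalClosure ((ext k).geom : Set (ext k).arith)).topologicalClosure = (ext k).geom := by
  rw [Subgroup.normalClosure_eq_self]
  exact le_antisymm (Subgroup.topologicalClosure_minimal _ le_rfl (ext k).isClosed_geom)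
    (Subgroup.le_topologicalClosure _)

/-- Every cusp of the junk model is rational (`D_x = Π ↠ G_k`).
[cite: MochizukiAbsTopIII2015, Prop 1.6 (ii) p.35] -/
theorem isRational (U : (model k).Curve) (c : ((model k).cusps U).Cusp) :
    ((model k).cusps U).IsRational c :=
  fun g _ => ⟨(g, 1), Subgroup.mem_top _, rfl⟩

/-- **The junk presentation `(U_x ⊆ X, x)` is a cyclotome presentation** in the sense of
`CurveModel.IsCyclotomePresentation`: scheme-like, `X` "proper", `x` rational, `I_x ≅ Ẑ`, cuspidal
kernel `= Ī_x`, and `1 → I_x → Δ^{c-cn} → Δ_X → 1` exact. [cite: MochizukiAbsTopIII2015, Prop 1.4 (ii) p.31] -/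
theorem isCyclotomePresentation (Ux X : (model k).Curve) (h : (model k).IsCofiniteOpen Ux X)
    (x : ((model k).cusps Ux).Cusp) : (model k).IsCyclotomePresentation h x where
  isScheme := ⟨trivial, trivial⟩
  isProper := trivial
  isRational := isRational k Ux x
  isFreeProcyclic := isFreeProcyclic_geom k
  kernel_eq := by
    change cuspidalKernel (resHom k) =
      (Subgroup.normalClosure ((ext k).geom : Set (ext k).arith)).topologicalClosure
    rw [cuspidalKernel_resHom, topologicalClosure_normalClosure_geom]
  isCuspidallyCentral := by
    change IsCuspidallyCentralExtension (resHom k) (ext k).geom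
    refine ⟨?_, ?_⟩
    · rw [cuspidallyCentralModulus_resHom, inf_bot_eq]
    · rw [cuspidallyCentralModulus_resHom, cuspidalKernel_resHom, sup_bot_eq]

/-! ### The nonconstant unit `X` and the trivial Kummer map -/

variable {k}

omit [CharZero k] in
/-- `X ∈ k(X)` is not a constant. [folklore] -/
private theorem X_not_mem_range : (RatFunc.X : RatFunc k) ∉ Set.range (algebraMap k (RatFunc k)) := by
  rintro ⟨a, ha⟩
  rw [RatFunc.algebraMap_eq_C] at ha
  have h := congrArg RatFunc.intDegree ha
  rw [RatFunc.intDegree_C, RatFunc.intDegree_X] at h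
  exact zero_ne_one h

/-- The regular unit `X ∈ K_U^× = Γ(U, 𝒪_U^×)` of the junk model.
[cite: MochizukiAbsTopIII2015, Prop 1.6 p.34] -/
def unitX : (model k).regularUnits PUnit.unit :=
  ⟨Units.mk0 (RatFunc.X : RatFunc k) RatFunc.X_ne_zero, Subgroup.mem_top _⟩

/-- `X` is nonconstant, in the model's phrasing. [cite: MochizukiAbsTopIII2015, Prop 1.6 (iii) p.35] -/
theorem unitX_not_mem_range :
    (((unitX : (model k).regularUnits PUnit.unit) : ((model k).FunctionField PUnit.unit)ˣ) :
        (model k).FunctionField PUnit.unit)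
      ∉ Set.range (algebraMap ((model k).base PUnit.unit) ((model k).FunctionField PUnit.unit)) :=
  X_not_mem_range

/-- The junk Kummer map is trivial. [cite: MochizukiAbsTopIII2015, Prop 1.6 p.34] -/
theorem toAdd_kummer {U Ux X : (model k).Curve} (h₁ : (model k).IsCofiniteOpen U Ux)
    (h₂ : (model k).IsCofiniteOpen Ux X) (f : (model k).regularUnits U) :
    Multiplicative.toAdd ((model k).kummer h₁ h₂ f) = 0 := rfl

omit [CharZero k] in
/-- `X ≠ 1` in `k(X)`. [folklore] -/
private theorem X_ne_one : (RatFunc.X : RatFunc k) ≠ 1 := by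
  intro h
  have h' := congrArg RatFunc.intDegree h
  rw [RatFunc.intDegree_X, RatFunc.intDegree_one] at h'
  exact one_ne_zero h'

/-- The junk Kummer map is NOT injective (`κ_U(X) = 1 = κ_U(1)` while `X ≠ 1`) — reusable for the
sibling row F-0342 `Prop_1_6_i` (injectivity of `κ_U`) at the same cyclotome presentation.
[cite: MochizukiAbsTopIII2015, Prop 1.6 (i) p.34] -/
theorem kummer_not_injective {U Ux X : (model k).Curve} (h₁ : (model k).IsCofiniteOpen U Ux)
    (h₂ : (model k).IsCofiniteOpen Ux X) : ¬ Function.Injective ((model k).kummer h₁ h₂) := by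
  intro hinj
  have h : (unitX : (model k).regularUnits U) = 1 := hinj rfl
  exact X_ne_one (k := k) (congrArg (fun u : (model k).regularUnits U =>
    ((u : ((model k).FunctionField U)ˣ) : (model k).FunctionField U)) h)

/-- Restriction of continuous cohomology classes sends `0` to `0`.
[cite: MochizukiAbsTopIII2015, Prop 1.6 (iii) p.35] -/
theorem geomCyclotomeH1Res_zero {E' E F : FundamentalExtension.{0}} (r : E' ⟶ E) (q : E ⟶ F)
    (D : Subgroup E'.arith) : (geomCyclotomeH1Res r q D) 0 = 0 :=
  map_zero _

/-! ### The three refutations at the junk model -/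

/-- **F-0343 at the junk model**: if `k` is Kummer-faithful, `Prop_1_6_iii_units (model k)` FAILS —
`κ_U(X) = 0` restricts to `0` on every cuspidal inertia group, yet `X` is not constant.
[cite: MochizukiAbsTopIII2015, Prop 1.6 (iii) p.35] -/
theorem not_prop_1_6_iii_units (hk : IsKummerFaithful k) : ¬ Prop_1_6_iii_units (model k) := by
  intro h
  refine unitX_not_mem_range ((h PUnit.unit PUnit.unit PUnit.unit trivial trivial PUnit.unit trivial
    (isCyclotomePresentation k _ _ _ _) hk (isRational k PUnit.unit) unitX).mp fun c => ?_)
  rw [toAdd_kummer]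
  exact geomCyclotomeH1Res_zero _ _ _

/-- **F-0344 at the junk model**: if `k` is Kummer-faithful, `Prop_1_8_i_units (model k)` FAILS —
`X` is a nonconstant "NF-rational" unit, yet no positive multiple of `κ_U(X) = 0` has a nonzero
restriction anywhere. [cite: MochizukiAbsTopIII2015, Prop 1.8 (i) p.36] -/
theorem not_prop_1_8_i_units (hk : IsKummerFaithful k) : ¬ Prop_1_8_i_units (model k) := by
  intro h
  obtain ⟨n, -, x₁, x₂, -, -, -, hne⟩ := (h PUnit.unit PUnit.unit PUnit.unit trivial trivial
    PUnit.unit trivial (isCyclotomePresentation k _ _ _ _) hk (isRational k PUnit.unit) trivial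
    unitX).mp ⟨trivial, unitX_not_mem_range⟩
  refine hne ?_
  rw [toAdd_kummer, smul_zero]
  exact geomCyclotomeH1Res_zero _ _ _

/-- **F-0345 at the junk model**: if `k` is Kummer-faithful, `Prop_1_8_ii_units (model k)` FAILS —
the constant `1` is declared NOT an NF-constant, yet `κ_U(X)|_y = 0 = κ_U(1)|_y` at the NF-point `y`
for the nonconstant NF-rational unit `X`. [cite: MochizukiAbsTopIII2015, Prop 1.8 (ii) p.36] -/
theorem not_prop_1_8_ii_units (hk : IsKummerFaithful k) : ¬ Prop_1_8_ii_units (model k) := by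
  intro h
  have hc : Units.map (algebraMap ((model k).base PUnit.unit) ((model k).FunctionField PUnit.unit) :
      (model k).base PUnit.unit →* (model k).FunctionField PUnit.unit) 1
        ∈ (model k).regularUnits PUnit.unit :=
    Subgroup.mem_top _
  exact (h PUnit.unit PUnit.unit PUnit.unit trivial trivial PUnit.unit trivial
    (isCyclotomePresentation k _ _ _ _) hk (isRational k PUnit.unit) trivial
    ⟨unitX, trivial, unitX_not_mem_range⟩ 1 hc).mpr
    ⟨unitX, PUnit.unit, trivial, unitX_not_mem_range, trivial, by rw [toAdd_kummer, toAdd_kummer]⟩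

end KummerUnitsClosureWitness

/-! ### The universal closures of F-0343 / F-0344 / F-0345 are false modulo one Kummer-faithful field -/

/-- **F-0343 is a schema, not a fact** (modulo the existence of a Kummer-faithful field): for every
Kummer-faithful field `k` of characteristic zero the junk model over `k` violates `Prop_1_6_iii_units`,
so `∀ M, Prop_1_6_iii_units M` is false. [cite: MochizukiAbsTopIII2015, Prop 1.6 (iii) p.35] -/
theorem not_forall_prop_1_6_iii_units_of_isKummerFaithful {k : Type} [Field k]
    (hk : IsKummerFaithful k) : ¬ ∀ M : KummerCurveModel.{0}, Prop_1_6_iii_units M := by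
  haveI := hk.torally.charZero
  exact fun h => KummerUnitsClosureWitness.not_prop_1_6_iii_units hk (h _)

/-- **F-0344 is a schema, not a fact** (modulo the existence of a Kummer-faithful field).
[cite: MochizukiAbsTopIII2015, Prop 1.8 (i) p.36] -/
theorem not_forall_prop_1_8_i_units_of_isKummerFaithful {k : Type} [Field k]
    (hk : IsKummerFaithful k) : ¬ ∀ M : KummerCurveModel.{0}, Prop_1_8_i_units M := by
  haveI := hk.torally.charZero
  exact fun h => KummerUnitsClosureWitness.not_prop_1_8_i_units hk (h _)

/-- **F-0345 is a schema, not a fact** (modulo the existence of a Kummer-faithful field).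
[cite: MochizukiAbsTopIII2015, Prop 1.8 (ii) p.36] -/
theorem not_forall_prop_1_8_ii_units_of_isKummerFaithful {k : Type} [Field k]
    (hk : IsKummerFaithful k) : ¬ ∀ M : KummerCurveModel.{0}, Prop_1_8_ii_units M := by
  haveI := hk.torally.charZero
  exact fun h => KummerUnitsClosureWitness.not_prop_1_8_ii_units hk (h _)

/-- **The closed form of F-0343 is EQUIVALENT to the non-existence of Kummer-faithful fields** (in
`Type`): bound as a closed fact, `∀ M, Prop_1_6_iii_units M` says exactly that [AbsTopIII] Def. 1.5 is
never satisfied — the opposite of Rmk. 1.5.4 (i) p. 33 ("every sub-`p`-adic field is Kummer-faithful").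
[cite: MochizukiAbsTopIII2015, Prop 1.6 (iii) p.35] -/
theorem forall_prop_1_6_iii_units_iff_no_kummerFaithful :
    (∀ M : KummerCurveModel.{0}, Prop_1_6_iii_units M) ↔
      ∀ (k : Type) [Field k], ¬ IsKummerFaithful k :=
  ⟨fun h _ _ hk => not_forall_prop_1_6_iii_units_of_isKummerFaithful hk h,
    fun hno M U _ _ _ _ _ _ _ hk => absurd hk (hno (M.base U))⟩

/-- **The closed form of F-0344 is EQUIVALENT to the non-existence of Kummer-faithful fields.**
[cite: MochizukiAbsTopIII2015, Prop 1.8 (i) p.36] -/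
theorem forall_prop_1_8_i_units_iff_no_kummerFaithful :
    (∀ M : KummerCurveModel.{0}, Prop_1_8_i_units M) ↔
      ∀ (k : Type) [Field k], ¬ IsKummerFaithful k :=
  ⟨fun h _ _ hk => not_forall_prop_1_8_i_units_of_isKummerFaithful hk h,
    fun hno M U _ _ _ _ _ _ _ hk => absurd hk (hno (M.base U))⟩

/-- **The closed form of F-0345 is EQUIVALENT to the non-existence of Kummer-faithful fields.**
[cite: MochizukiAbsTopIII2015, Prop 1.8 (ii) p.36] -/
theorem forall_prop_1_8_ii_units_iff_no_kummerFaithful :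
    (∀ M : KummerCurveModel.{0}, Prop_1_8_ii_units M) ↔
      ∀ (k : Type) [Field k], ¬ IsKummerFaithful k :=
  ⟨fun h _ _ hk => not_forall_prop_1_8_ii_units_of_isKummerFaithful hk h,
    fun hno M U _ _ _ _ _ _ _ hk => absurd hk (hno (M.base U))⟩

/-- **Under FACT-LIST row F-0369 (`Rmk_1_5_4_i`, "sub-`p`-adic ⟹ Kummer-faithful", [AbsTopIII]
Rmk. 1.5.4 (i) p. 33) the universal closure of F-0343 is FALSE**: `ℚ_2` is sub-`2`-adic, hence
Kummer-faithful, and the junk model over `ℚ_2` violates `Prop_1_6_iii_units`.  The closed forms of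
F-0343 and F-0369 are jointly inconsistent.  (`IsSubpadic ℚ_[2]` is also
`pGC.isSubpadic_padicTwo` of `RelativeGCHomSchemaWitnesses.lean`, not imported here.) [cite: MochizukiAbsTopIII2015, Prop 1.6 (iii) p.35] -/
theorem not_forall_prop_1_6_iii_units_of_rmk_1_5_4_i (h154 : Rmk_1_5_4_i.{0}) :
    ¬ ∀ M : KummerCurveModel.{0}, Prop_1_6_iii_units M :=
  not_forall_prop_1_6_iii_units_of_isKummerFaithful (h154 ℚ_[2] ⟨⟨2, inferInstance, IsSubpadicFor.padic 2⟩⟩)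

/-- **Under F-0369 (`Rmk_1_5_4_i`) the universal closure of F-0344 is FALSE.**
[cite: MochizukiAbsTopIII2015, Prop 1.8 (i) p.36] -/
theorem not_forall_prop_1_8_i_units_of_rmk_1_5_4_i (h154 : Rmk_1_5_4_i.{0}) :
    ¬ ∀ M : KummerCurveModel.{0}, Prop_1_8_i_units M :=
  not_forall_prop_1_8_i_units_of_isKummerFaithful (h154 ℚ_[2] ⟨⟨2, inferInstance, IsSubpadicFor.padic 2⟩⟩)

/-- **Under F-0369 (`Rmk_1_5_4_i`) the universal closure of F-0345 is FALSE.**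
[cite: MochizukiAbsTopIII2015, Prop 1.8 (ii) p.36] -/
theorem not_forall_prop_1_8_ii_units_of_rmk_1_5_4_i (h154 : Rmk_1_5_4_i.{0}) :
    ¬ ∀ M : KummerCurveModel.{0}, Prop_1_8_ii_units M :=
  not_forall_prop_1_8_ii_units_of_isKummerFaithful (h154 ℚ_[2] ⟨⟨2, inferInstance, IsSubpadicFor.padic 2⟩⟩)

end Literature.AnabelianGeometry.AbsoluteAnabelian.AbsTopIII
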